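import Summits.BirchSwinnertonDyer.Rank1Residual.ManinAdditive.CongruenceExcessLaws
import HarnessLib
import HarnessLib.Audit.Tags

/-!
# «THE E-FACING PROFILE OF THE GHOST DROP AT 3: the two cells the desc laws leave open at 9 ∥ N» — rows E-imc-181 / E-imc-182 typed
# (cell `bsd-f2-manin`, planner `imc` g23, MEMO-imc §29.8 (d), HOME/imc/kit-g23/PROOFS-g23.md §5.10; T-imc-37; nothing asserted)

TYPER NOTE (typer g19, T-imc-37).  SOURCE = HOME/imc/kit-g23/Sketch-imc-g23c.lean sha16 ed327a6835662d19 (114 l.; farm rc 0 · 0 err · 0 warn per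
imc; BC7 2/2 CLEAN, record HOME/imc/kit-g23/g23c-bc7.raw.txt a4fb47b59677d295), landed VERBATIM except: (i) this note; (ii) `import
HarnessLib.Audit.CruxProbe` and the two `#h21_crux_probe` commands dropped.  Namespace `…ManinAdditive.GhostDropKodaira` as written; frame,
binders and rendering are those of the tree leaf `CongruenceExcessLaws.lean` (desc g2, rows E-desc-14♭ / 16 / 18), its only Summits import —
ROUTE-INDEPENDENT.  The sketch's own module docstring (imc's words, census table included) follows this note unchanged.

HONEST FRAMING.  LENS: imc (the ghost drop `x₃(E) := ord₃ r_E − ord₃ m_E` of PROOFS-g23 §5.9 resolved by Kodaira type, `v₃(j)` and `E[3]` at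
`9 ∥ N`).  STATUS: E-imc-181 `IzeroStarThreeExcessLaw` and E-imc-182 `TypeThreeReducibleNoExcess` are CONJECTURAL cell laws (LAW-candidates);
the PROVED edge `typeThree_excess_le_one` is bookkeeping (E-desc-18 ∧ E-imc-182 ⟹ the printed Agashe–Ribet–Stein ceiling `x₃ ≤ 1` on type III).
NOT IN PRINT as statements: nearest print BY NAME = tree `Literature…AgasheRibetStein2012_conjecture` (ceiling `ord₃(r_E/m_E) ≤ 1` at `9 ∥ N`)
and its Thm. 2.1 `m_E ∣ r_E`; no Kodaira- or `j`-resolved VALUE of `x₃` on `I₀*` / reducible III is in print (imc §29.8 (d); ref2 R-imc-72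
placement of «`x₃` on `I₀*` = [good twist supersingular]» and «reducible III is `χ₋₃`-twist-stable with `x₃ = 0`» PENDING).  BC5 WITNESS (imc
ENGINE 7, HOME/imc/kit-g20, all 506 optimal classes `9 ∥ N ≤ 1296`, × the data seat's AUTOTYPE23 table; second engine for `r_E`: CONGNUM-N1500
agrees with ENGINE 7 on 983/983 shared labels, ARS 2012 Table 1 on 21/21): E-181 (a) 32/32, (b) 44/44; E-182 43/43; E-imc-183 (words only, not
typed): reducible `I₀*` with `v₃(j) = 0` splits 8 / 19; violations 0.  REFUTER VERDICTS: ref1/ref2 R-imc-72 (A1–A6 of the two Props + audit of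
PROOFS-g23 §5.10 05fcc5379944fe95) PENDING at filing.  CHEAPEST FALSIFIERS (imc): an optimal `I₀*` curve at `9 ∥ N` with `v₃(j) > 0` and
`x₃ ≠ 1`, or with `v₃(j) = 0`, `E[3]` irreducible and `x₃ ≠ 0` (a CM `j = 1728` or `9`-isogenous configuration beyond 1296 is the stated risk);
a reducible type-III optimal curve with `x₃ ≠ 0` (D-imc-36 (a) extends to `9 ∥ N ≤ 5000`).  WHY IT MATTERS: completes the E-facing `x₃` profile
at `v₃(N) = 2` left open by E-desc-14♭/16/18, i.e. the Kodaira-resolved reading of the ghost drop `d_f` of E-imc-180 (`GhostDropARS.lean`).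
PARTITION currency: ladder-adjacent + frontier-data; beyond-print theorem: NO; bears_on: stmt-BirchSwinnertonDyer-22968 (C3) only through the
ghost-drop bookkeeping (no Manin binder here: the rows read `r_E` and `m_E`, not `c`).  BSD is not proved by this; Manin's conjecture is not
proved by this; C2/C3 OPEN.
-/

/-!
# Sketch-imc-g23c — THE `E`-FACING PROFILE OF THE GHOST DROP AT 3: the two cells the desc laws leave
# open at `9 ∥ N` (imc g23, MEMO-imc §29.8 (d); HOME/imc/kit-g23/PROOFS-g23.md §5.10)

Frame, binders and rendering VERBATIM those of the tree leaf
`Summits/BirchSwinnertonDyer/Rank1Residual/ManinAdditive/CongruenceExcessLaws.lean` (desc g2, rows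
E-desc-14♭ / 16 / 18): `W` globally minimal, datum `D` at the conductor level, the lattice clause
(`φ_D` optimal) and the minimal-degree clause, so that `congruenceNumber D.f = r_E`, `D.modularDegree = m_E`,
`x₃(E) := ord₃ r_E − ord₃ m_E`.  At `v₃(N) = 2` the desc laws decide `x₃` on the RIGID types (`III*`,
`Iₙ*` with `E[3]` irreducible ⇒ `x₃ = 0`, E-desc-14♭) and on type `III` with `E[3]` irreducible
(`x₃ = 1`, E-desc-18); they are silent on type `I₀*` («`I₀*` is not an exception there») and on type
`III` with `E[3]` reducible.  ENGINE 7 (HOME/imc/kit-g20, all 506 optimal classes with `9 ∥ N ≤ 1296`)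
× the data seat's AUTOTYPE23 table (Kodaira / `v₃(j)` / isogeny primes) gives, with 0 exceptions:

| stratum at `3` (`9 ∥ N`)                          | classes | `x₃ = ord₃(r_E/m_E)` |
|---------------------------------------------------|--------:|----------------------|
| `I₀*`, `v₃(j_E) > 0` (twist of good SUPERSINGULAR) |      32 | `1` (32/32)          |
| `I₀*`, `v₃(j_E) = 0`, `E[3]` irreducible           |      44 | `0` (44/44)          |
| `I₀*`, `v₃(j_E) = 0`, `E[3]` reducible             |      27 | `1` on 8, `0` on 19 (E-imc-183, words only) |
| `III`, `E[3]` reducible                             |      43 | `0` (43/43)          |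
| `III`, `E[3]` irreducible (= E-desc-18 at `p = 3`)  |      59 | `1` (59/59)          |
| `III*` (= E-desc-14♭; none has a `3`-isogeny)       |      59 | `0` (59/59)          |
| `Iₙ*`, `n ≥ 1` (E-desc-14♭; 29 reducible included)  |     242 | `0` (242/242)        |

(at `v₃(N) = 2`, type `I₀*` has `v₃(j) ∈ {0, 3}` in the whole range; `v₃(j) > 0 ⟺` the good twist
`E ⊗ χ₋₃` is supersingular at `3`, since `j ≡ 0 = 1728` is the only supersingular invariant mod `3`).
Second engine for the `r_E` column: the data seat's CONGNUM-N1500 table agrees with ENGINE 7 on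
983/983 shared labels; ARS 2012 Table 1 on 21/21.  Nothing here is asserted; both leaves are
conjectures of the cell (BC5 = the table above); nothing here proves BSD or Manin's conjecture.
-/

noncomputable section

open scoped MatrixGroups ModularForm

open CongruenceSubgroup WeierstrassCurve
  Literature.NumberTheory.EllipticCurves Literature.NumberTheory.EllipticCurves.ModularForms
  Literature.NumberTheory.DiophantineGeometry

namespace Summit.BirchSwinnertonDyer.Rank1Residual.ManinAdditive.GhostDropKodaira

/-- **Candidate E-imc-181 `IzeroStarThreeExcessLaw`** (a CONJECTURE of the cell; nothing asserted).
`X₀(N)`-optimal `E`, `v₃(N) = 2`, Kodaira type `I₀*` at `3` (so `E = E' ⊗ χ₋₃` with `E'` of good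
reduction at `3`): (a) `v₃(j_E) > 0` (⟺ `E'` supersingular at `3`) ⇒ `v₃(r_E) = v₃(m_E) + 1`;
(b) `v₃(j_E) = 0` (⟺ `E'` ordinary) and `E[3]` irreducible ⇒ `v₃(r_E) = v₃(m_E)`.
Census 32/32 + 44/44 (`9 ∥ N ≤ 1296`).  With the desc seat's degree law `v₃(m_E) = v₃(m_{E'}) +
[E' ordinary at 3]` (MEMO-desc §9) it reads «`v₃(r_E) = v₃(m_{E'}) + 1` always»: the one extra `3`
sits in the degree when `E'` is ordinary and in the congruence excess when `E'` is supersingular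
(checked 18/18 where `m_{E'}` is tabulated).  Why it might fail: a CM (`j = 1728`) or `9`-isogenous
configuration outside the range; (b) is false without irreducibility (8 classes, E-imc-183).
[cite: AgasheRibetStein2012, Thm. 2.1 and Conj. 2.2 (shape and ceiling only; no Kodaira- or j-resolved value of ord₃(r_E/m_E) on type I₀* is in print — cell bsd-f2-manin MEMO-imc §29.8 (d), E-imc-181)] -/
@[conjecture] def IzeroStarThreeExcessLaw : Prop :=
  ∀ (W : WeierstrassCurve ℚ) [W.IsElliptic] [W.IsGloballyMinimal] [NeZero (W.conductorNorm ℤ)]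
    (D : ModularParametrizationData W (W.conductorNorm ℤ)),
    (∀ z ∈ D.L.lattice, ∃ w ∈ periodLattice D.f, z = D.c * w) →
    (∀ (W' : WeierstrassCurve ℚ) [W'.IsElliptic]
        (D' : ModularParametrizationData W' (W.conductorNorm ℤ)),
        D'.f = D.f → D.modularDegree ≤ D'.modularDegree) →
    padicValNat 3 (W.conductorNorm ℤ) = 2 →
    W.kodairaSymbolAt ((Rat.HeightOneSpectrum.primesEquiv (R := ℤ)).symm ⟨3, Nat.prime_three⟩) =
      KodairaSymbol.Istar 0 →
    (0 < padicValRat 3 W.j →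
        padicValNat 3 (congruenceNumber D.f) = padicValNat 3 D.modularDegree + 1) ∧
    (padicValRat 3 W.j = 0 → W.HasIrreducibleModPGaloisRep 3 →
        padicValNat 3 (congruenceNumber D.f) = padicValNat 3 D.modularDegree)

/-- **Candidate E-imc-182 `TypeThreeReducibleNoExcess`** (a CONJECTURE of the cell; nothing
asserted).  `X₀(N)`-optimal `E`, `v₃(N) = 2`, Kodaira type `III` at `3`, `E[3]` REDUCIBLE ⇒
`v₃(r_E) = v₃(m_E)` — the complement of E-desc-18 at `p = 3` (which gives `x₃ = 1` when `E[3]` is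
irreducible).  Census 43/43 (`9 ∥ N ≤ 1296`; in the range every such class is stable under the
`χ₋₃`-twist and no optimal `III*` curve has a rational `3`-isogeny, 0/59).  Why it might fail: the
Eisenstein ideal at `3` could still carry a non-geometric congruence at larger level (cf. `1953g1`,
`I₉*`, `9`-isogeny, `x₃ = 1`, in the reducible `Iₙ*` cell).
[cite: AgasheRibetStein2012, Conj. 2.2 and Prop. 2.3 (ceiling ord₃(r_E/m_E) ≤ 1 at 9 ∥ N only; the value 0 on the reducible type-III stratum is NOT in print — cell bsd-f2-manin MEMO-imc §29.8 (d), E-imc-182)] -/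
@[conjecture] def TypeThreeReducibleNoExcess : Prop :=
  ∀ (W : WeierstrassCurve ℚ) [W.IsElliptic] [W.IsGloballyMinimal] [NeZero (W.conductorNorm ℤ)]
    (D : ModularParametrizationData W (W.conductorNorm ℤ)),
    (∀ z ∈ D.L.lattice, ∃ w ∈ periodLattice D.f, z = D.c * w) →
    (∀ (W' : WeierstrassCurve ℚ) [W'.IsElliptic]
        (D' : ModularParametrizationData W' (W.conductorNorm ℤ)),
        D'.f = D.f → D.modularDegree ≤ D'.modularDegree) →
    padicValNat 3 (W.conductorNorm ℤ) = 2 →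
    W.kodairaSymbolAt ((Rat.HeightOneSpectrum.primesEquiv (R := ℤ)).symm ⟨3, Nat.prime_three⟩) =
      KodairaSymbol.III →
    ¬ W.HasIrreducibleModPGaloisRep 3 →
    padicValNat 3 (congruenceNumber D.f) = padicValNat 3 D.modularDegree

/-- Bookkeeping edge (PROVED): on type `III` at `v₃(N) = 2` the two leaves E-desc-18 (tree,
`TameIrreducibleUnitExcess`, irreducible ⇒ `x₃ = 1`) and E-imc-182 (reducible ⇒ `x₃ = 0`) together
give the printed Agashe–Ribet–Stein ceiling `x₃ ≤ 1` on that stratum, by cases on irreducibility. -/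
theorem typeThree_excess_le_one (h18 : TameIrreducibleUnitExcess) (h182 : TypeThreeReducibleNoExcess)
    (W : WeierstrassCurve ℚ) [W.IsElliptic] [W.IsGloballyMinimal] [NeZero (W.conductorNorm ℤ)]
    (D : ModularParametrizationData W (W.conductorNorm ℤ))
    (hL : ∀ z ∈ D.L.lattice, ∃ w ∈ periodLattice D.f, z = D.c * w)
    (hmin : ∀ (W' : WeierstrassCurve ℚ) [W'.IsElliptic]
        (D' : ModularParametrizationData W' (W.conductorNorm ℤ)),
        D'.f = D.f → D.modularDegree ≤ D'.modularDegree)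
    (hv : padicValNat 3 (W.conductorNorm ℤ) = 2)
    (hK : W.kodairaSymbolAt ((Rat.HeightOneSpectrum.primesEquiv (R := ℤ)).symm ⟨3, Nat.prime_three⟩) =
      KodairaSymbol.III) :
    padicValNat 3 (congruenceNumber D.f) ≤ padicValNat 3 D.modularDegree + 1 := by
  by_cases hirr : W.HasIrreducibleModPGaloisRep 3
  · have h := h18 W D hL hmin 3 Nat.prime_three (by norm_num) hv (Or.inr (Or.inl hK)) hirr
    omega
  · have h := h182 W D hL hmin hv hK hirr
    omega

end Summit.BirchSwinnertonDyer.Rank1Residual.ManinAdditive.GhostDropKodaira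

end
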